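import Literature.NumberTheory.LFunctions.KowalskiMichelPeterssonBoundWeilFree
import Literature.NumberTheory.ModularForms.PoincareSeriesWeightTwoHecke
import HarnessLib

/-!
# Kowalski–Michel's `J_N(m, n)` at EVERY level `N`: absolute convergence and a polynomial bound from
# Weil's bound (the coefficient bound of the weight-2 Poincaré series)

Topic `Literature/NumberTheory/LFunctions` (namespace `Literature.NumberTheory.LFunctions.KowalskiMichel2000`).
THEOREMS ONLY (no definition, no named fact).

Kowalski–Michel, Acta Arith. 94 (2000), §2.4.2 p. 312, define (at prime level `q`)
`J(l₁,l₂) = (2π/q) ∑_{r≥1} r⁻¹ S(l₁,l₂;qr) J₁(4π√(l₁l₂)/(qr))` and note "the trivial bound for this,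
from Weil's bound for Kloosterman sums and `J₁(x) ≪ x`". The tree's `petJ N m n` is this series at an
arbitrary level `N`; its `n`-th value is (up to `δ(m,n)` and the factor `√n/√m`) the printed Fourier
coefficient of the weight-2 Poincaré series of `Γ₀(N)` (Iwaniec–Kowalski Lemma 14.2),
`poincareCoeff N m n` of `PoincareSeriesWeightTwoHecke.lean`. The companion file
`KowalskiMichelPeterssonBoundWeilFree.lean` proves absolute convergence at PRIME level
(`summable_norm_petKloostermanTerm_all`, using `τ(qr) ≤ 2τ(r)`). Here, for ALL `N ≥ 1`, `m ≥ 1`, `n`: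

* `norm_petKloostermanTerm_le_allLevels` — termwise, from Weil's bound (`weil_kloosterman_bound_holds`),
  the crude gcd bound `((m,n),Nr) ≤ (m,n)`, a divisor bound `τ(k) ≤ C k^{1/4}` applied to `k = Nr`,
  and `|J₁(x)| ≤ x/2`: `|r⁻¹ S(m,n;Nr) J₁(4π√(mn)/(Nr))| ≤ 2π C √(m,n) √(mn) N^{−1/4} r^{−5/4}`;
* `summable_norm_petKloostermanTerm_allLevels` — absolute convergence of the `r`-series;
* `norm_petJ_le_allLevels` — `|J_N(m,n)| ≤ K √(m,n) √(mn) N^{−5/4}` with an absolute `K`;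
* `norm_poincareCoeff_le` — the polynomial bound `|p_m(n)| ≤ 1 + K n^{3/2}` on the printed
  Poincaré coefficients (what makes the `q`-series `poincareQSeries N m` converge: stub T3/T7 of the
  I1 skeleton `poincare_hecke`).

## References

* [KowalskiMichel2000] E. Kowalski, P. Michel, Acta Arith. 94 (2000), §2.4.2 p. 312 ((23) and its proof
  "from Weil's bound … and `J₁(x) ≪ x`").
* [IwaniecKowalski2004] H. Iwaniec, E. Kowalski, *Analytic Number Theory*, Lemma 14.2, (14.13)–(14.15).
* [Iwaniec2002] H. Iwaniec, *Spectral Methods*, (2.25) (Weil's bound; tree theorem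
  `weil_kloosterman_bound_holds`).
-/

noncomputable section

open scoped Real
open Literature.Analysis.FunctionSpaces (besselJ abs_besselJ_one_le_half_mul)
open Literature.NumberTheory.ModularForms.PoincareWeightTwo (poincareCoeff)

namespace Literature.NumberTheory.LFunctions.KowalskiMichel2000

/-- **One term of `J_N(m,n)` at an arbitrary level** (`N ≥ 1`, `m ≥ 1`, any `n`, any `r`): given a
divisor bound `τ(k) ≤ C k^{1/4}`,
`|r⁻¹ S(m,n;Nr) J₁(4π√(mn)/(Nr))| ≤ 2π C √(m,n) √(mn) N^{−1/4} r^{−5/4}` — Weil's bound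
`|S| ≤ ((m,n),Nr)^{1/2} (Nr)^{1/2} τ(Nr)`, `((m,n),Nr) ≤ (m,n)`, `τ(Nr) ≤ C (Nr)^{1/4}`, `|J₁(x)| ≤ x/2`.
[cite: KowalskiMichel2000, §2.4.2 p. 312 (23) (proof: "from Weil's bound … and J₁(x) ≪ x")] -/
theorem norm_petKloostermanTerm_le_allLevels {N : ℕ} [NeZero N] {m n : ℕ} (hm : 1 ≤ m)
    {C : ℝ} (hC : ∀ k : ℕ, ((k.divisors.card : ℕ) : ℝ) ≤ C * (k : ℝ) ^ (1 / 4 : ℝ)) (r : ℕ) :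
    ‖petKloostermanTerm N m n r‖ ≤
      2 * π * C * Real.sqrt ((m.gcd n : ℕ) : ℝ) * Real.sqrt ((m : ℝ) * n) *
        (N : ℝ) ^ (-(1 / 4 : ℝ)) * (r : ℝ) ^ (-(5 / 4 : ℝ)) := by
  rcases eq_or_ne r 0 with rfl | hr
  · have h0 : ((0 : ℕ) : ℝ) ^ (-(5 / 4 : ℝ)) = 0 := by
      rw [Nat.cast_zero]
      exact Real.zero_rpow (by norm_num)
    rw [petKloostermanTerm_zero, norm_zero, h0, mul_zero]
  have hN : N ≠ 0 := NeZero.ne N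
  haveI : NeZero (N * r) := ⟨mul_ne_zero hN hr⟩
  have hN0 : (0 : ℝ) < N := by exact_mod_cast Nat.pos_of_ne_zero hN
  have hr0 : (0 : ℝ) < r := by exact_mod_cast Nat.pos_of_ne_zero hr
  have hNr0 : (0 : ℝ) < (N : ℝ) * r := mul_pos hN0 hr0
  have hC0 : 0 ≤ C := by
    have h := hC 1
    simp at h
    linarith
  set g : ℕ := m.gcd n with hgdef
  have hgpos : 0 < g := Nat.gcd_pos_of_pos_left n (by omega)
  -- Weil's bound (a theorem of the tree) at modulus `Nr`
  have hWeil : ‖kloostermanSum (N * r) (m : ZMod (N * r)) (n : ZMod (N * r))‖ ≤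
      Real.sqrt (Nat.gcd g (N * r) : ℕ) * Real.sqrt ((N : ℝ) * r) *
        (((N * r).divisors.card : ℕ) : ℝ) := by
    have h := weil_kloosterman_bound_holds (N * r) (m : ℤ) (n : ℤ)
    simp only [Int.cast_natCast, Int.natAbs_natCast, Nat.cast_mul] at h
    exact h
  -- the crude gcd bound, the divisor bound at `Nr`, and the Bessel bound
  have hgcd : Real.sqrt (Nat.gcd g (N * r) : ℕ) ≤ Real.sqrt (g : ℝ) :=
    Real.sqrt_le_sqrt (by exact_mod_cast Nat.gcd_le_left (N * r) hgpos)
  have hτ : (((N * r).divisors.card : ℕ) : ℝ) ≤ C * ((N : ℝ) ^ (1 / 4 : ℝ) * (r : ℝ) ^ (1 / 4 : ℝ)) := by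
    have h := hC (N * r)
    rwa [Nat.cast_mul, Real.mul_rpow hN0.le hr0.le] at h
  have hx0 : 0 ≤ 4 * π * Real.sqrt ((m : ℝ) * n) / ((N : ℝ) * r) := by positivity
  have hJ : |besselJ 1 (4 * π * Real.sqrt ((m : ℝ) * n) / ((N : ℝ) * r))| ≤
      (4 * π * Real.sqrt ((m : ℝ) * n) / ((N : ℝ) * r)) / 2 := abs_besselJ_one_le_half_mul hx0
  -- assemble
  rw [petKloostermanTerm_of_ne_zero N m n hr]
  rw [norm_mul, norm_mul, norm_inv, Complex.norm_natCast, Complex.norm_real, Real.norm_eq_abs]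
  calc (r : ℝ)⁻¹ * ‖kloostermanSum (N * r) (m : ZMod (N * r)) (n : ZMod (N * r))‖ *
        |besselJ 1 (4 * π * Real.sqrt ((m : ℝ) * n) / ((N : ℝ) * r))|
      ≤ (r : ℝ)⁻¹ * (Real.sqrt (g : ℝ) * Real.sqrt ((N : ℝ) * r) *
          (C * ((N : ℝ) ^ (1 / 4 : ℝ) * (r : ℝ) ^ (1 / 4 : ℝ)))) *
          ((4 * π * Real.sqrt ((m : ℝ) * n) / ((N : ℝ) * r)) / 2) := by
        gcongr
        calc ‖kloostermanSum (N * r) (m : ZMod (N * r)) (n : ZMod (N * r))‖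
            ≤ Real.sqrt (Nat.gcd g (N * r) : ℕ) * Real.sqrt ((N : ℝ) * r) *
                (((N * r).divisors.card : ℕ) : ℝ) := hWeil
          _ ≤ Real.sqrt (g : ℝ) * Real.sqrt ((N : ℝ) * r) *
                (C * ((N : ℝ) ^ (1 / 4 : ℝ) * (r : ℝ) ^ (1 / 4 : ℝ))) := by gcongr
    _ = 2 * π * C * Real.sqrt (g : ℝ) * Real.sqrt ((m : ℝ) * n) *
          (N : ℝ) ^ (-(1 / 4 : ℝ)) * (r : ℝ) ^ (-(5 / 4 : ℝ)) := by
        rw [Real.sqrt_eq_rpow ((N : ℝ) * r), Real.mul_rpow hN0.le hr0.le]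
        have er : (r : ℝ)⁻¹ * (r : ℝ) ^ (1 / 2 : ℝ) * (r : ℝ) ^ (1 / 4 : ℝ) / (r : ℝ) =
            (r : ℝ) ^ (-(5 / 4 : ℝ)) := by
          rw [← Real.rpow_neg_one, div_eq_mul_inv, ← Real.rpow_neg_one, ← Real.rpow_add hr0,
            ← Real.rpow_add hr0, ← Real.rpow_add hr0]
          congr 1
          ring
        have eN : (N : ℝ) ^ (1 / 2 : ℝ) * (N : ℝ) ^ (1 / 4 : ℝ) / (N : ℝ) = (N : ℝ) ^ (-(1 / 4 : ℝ)) := by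
          rw [div_eq_mul_inv, ← Real.rpow_neg_one, ← Real.rpow_add hN0, ← Real.rpow_add hN0]
          congr 1
          ring
        calc (r : ℝ)⁻¹ * (Real.sqrt (g : ℝ) * ((N : ℝ) ^ (1 / 2 : ℝ) * (r : ℝ) ^ (1 / 2 : ℝ)) *
              (C * ((N : ℝ) ^ (1 / 4 : ℝ) * (r : ℝ) ^ (1 / 4 : ℝ)))) *
              ((4 * π * Real.sqrt ((m : ℝ) * n) / ((N : ℝ) * r)) / 2)
            = 2 * π * C * Real.sqrt (g : ℝ) * Real.sqrt ((m : ℝ) * n) *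
                ((N : ℝ) ^ (1 / 2 : ℝ) * (N : ℝ) ^ (1 / 4 : ℝ) / (N : ℝ)) *
                ((r : ℝ)⁻¹ * (r : ℝ) ^ (1 / 2 : ℝ) * (r : ℝ) ^ (1 / 4 : ℝ) / (r : ℝ)) := by
              field_simp
              ring
          _ = _ := by rw [er, eN]

/-- **The `r`-series of `J_N(m,n)` converges absolutely at every level** (`N ≥ 1`, `m ≥ 1`, any `n`;
termwise `≪ r^{−5/4}`). [cite: KowalskiMichel2000, §2.4.2 p. 312 (23)] -/
theorem summable_norm_petKloostermanTerm_allLevels {N : ℕ} [NeZero N] {m n : ℕ} (hm : 1 ≤ m) :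
    Summable (fun r : ℕ ↦ ‖petKloostermanTerm N m n r‖) := by
  obtain ⟨C, -, hC⟩ :=
    Literature.NumberTheory.Sieve.exists_card_divisors_le_mul_rpow' (by norm_num : (0 : ℝ) < 1 / 4)
  have hZ : Summable (fun r : ℕ ↦ (r : ℝ) ^ (-(5 / 4 : ℝ))) :=
    Real.summable_nat_rpow.mpr (by norm_num)
  exact Summable.of_nonneg_of_le (fun _ ↦ norm_nonneg _)
    (fun r ↦ norm_petKloostermanTerm_le_allLevels hm (fun k ↦ hC k) r) (hZ.mul_left _)

/-- **A uniform bound for `J_N(m,n)` at every level**: there is an absolute `K` with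
`|J_N(m,n)| ≤ K √(m,n) √(mn) N^{−5/4}` for all `N ≥ 1`, `m ≥ 1`, `n` (`K = 4π² C_{1/4} ζ(5/4)`).
[cite: KowalskiMichel2000, §2.4.2 p. 312 (23)] -/
theorem norm_petJ_le_allLevels :
    ∃ K : ℝ, 0 ≤ K ∧ ∀ (N : ℕ) [NeZero N] (m n : ℕ), 1 ≤ m →
      ‖petJ N m n‖ ≤ K * Real.sqrt ((m.gcd n : ℕ) : ℝ) * Real.sqrt ((m : ℝ) * n) *
        (N : ℝ) ^ (-(5 / 4 : ℝ)) := by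
  obtain ⟨C, hC1, hC⟩ :=
    Literature.NumberTheory.Sieve.exists_card_divisors_le_mul_rpow' (by norm_num : (0 : ℝ) < 1 / 4)
  have hC0 : (0 : ℝ) ≤ C := zero_le_one.trans hC1
  have hZs : Summable (fun r : ℕ ↦ (r : ℝ) ^ (-(5 / 4 : ℝ))) :=
    Real.summable_nat_rpow.mpr (by norm_num)
  set Z : ℝ := ∑' r : ℕ, (r : ℝ) ^ (-(5 / 4 : ℝ)) with hZ
  have hZ0 : 0 ≤ Z := tsum_nonneg fun r ↦ Real.rpow_nonneg (Nat.cast_nonneg _) _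
  refine ⟨4 * π ^ 2 * C * Z, by positivity, fun N _ m n hm ↦ ?_⟩
  have hN0 : (0 : ℝ) < N := by exact_mod_cast Nat.pos_of_ne_zero (NeZero.ne N)
  set A : ℝ := 2 * π * C * Real.sqrt ((m.gcd n : ℕ) : ℝ) * Real.sqrt ((m : ℝ) * n) *
    (N : ℝ) ^ (-(1 / 4 : ℝ)) with hA
  have hterm : ∀ r : ℕ, ‖petKloostermanTerm N m n r‖ ≤ A * (r : ℝ) ^ (-(5 / 4 : ℝ)) :=
    fun r ↦ norm_petKloostermanTerm_le_allLevels hm (fun k ↦ hC k) r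
  have has : Summable (fun r : ℕ ↦ ‖petKloostermanTerm N m n r‖) :=
    summable_norm_petKloostermanTerm_allLevels hm
  have htsum : ∑' r : ℕ, ‖petKloostermanTerm N m n r‖ ≤ A * Z := by
    calc ∑' r : ℕ, ‖petKloostermanTerm N m n r‖
        ≤ ∑' r : ℕ, A * (r : ℝ) ^ (-(5 / 4 : ℝ)) := Summable.tsum_le_tsum hterm has (hZs.mul_left A)
      _ = A * Z := by rw [tsum_mul_left]
  have hnorm : ‖(2 * π / N : ℂ)‖ = 2 * π / N := by
    rw [norm_div, norm_mul, Complex.norm_real, Complex.norm_natCast, Real.norm_eq_abs,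
      abs_of_pos Real.pi_pos, Complex.norm_two]
  have hJ : ‖petJ N m n‖ ≤ 2 * π / N * (A * Z) := by
    rw [petJ_def, norm_mul, hnorm]
    exact mul_le_mul_of_nonneg_left ((norm_tsum_le_tsum_norm has).trans htsum) (by positivity)
  refine hJ.trans (le_of_eq ?_)
  have hN54 : 2 * π / (N : ℝ) * (N : ℝ) ^ (-(1 / 4 : ℝ)) = 2 * π * (N : ℝ) ^ (-(5 / 4 : ℝ)) := by
    rw [div_eq_mul_inv, ← Real.rpow_neg_one, mul_assoc, ← Real.rpow_add hN0]
    norm_num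
  calc 2 * π / N * (A * Z)
      = (2 * π / (N : ℝ) * (N : ℝ) ^ (-(1 / 4 : ℝ))) * (2 * π * C * Z) *
          (Real.sqrt ((m.gcd n : ℕ) : ℝ) * Real.sqrt ((m : ℝ) * n)) := by rw [hA]; ring
    _ = 4 * π ^ 2 * C * Z * Real.sqrt ((m.gcd n : ℕ) : ℝ) * Real.sqrt ((m : ℝ) * n) *
          (N : ℝ) ^ (-(5 / 4 : ℝ)) := by rw [hN54]; ring

/-- **Polynomial bound on the printed Poincaré coefficients**: with the absolute `K` of
`norm_petJ_le_allLevels`, `‖poincareCoeff N m n‖ ≤ 1 + K · n · √n` for all `N, m, n ≥ 1` (using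
`√(m,n) ≤ √n` and `N^{−5/4} ≤ 1`), so the `q`-series `Σ_n p_m(n) e(nz)` converges absolutely on `ℍ`.
[cite: IwaniecKowalski2004, Lemma 14.2 ((14.15), trivial bound for the coefficients)] -/
theorem norm_poincareCoeff_le :
    ∃ K : ℝ, 0 ≤ K ∧ ∀ (N : ℕ) [NeZero N] (m n : ℕ), 1 ≤ m → 1 ≤ n →
      ‖poincareCoeff N m n‖ ≤ 1 + K * (n : ℝ) * Real.sqrt n := by
  obtain ⟨K, hK0, hK⟩ := norm_petJ_le_allLevels
  refine ⟨K, hK0, fun N _ m n hm hn ↦ ?_⟩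
  have hm0 : (0 : ℝ) < m := by exact_mod_cast hm
  have hn0 : (0 : ℝ) < n := by exact_mod_cast hn
  have hN1 : (1 : ℝ) ≤ N := by exact_mod_cast Nat.one_le_iff_ne_zero.mpr (NeZero.ne N)
  have hδ : ‖(if m = n then (1 : ℂ) else 0)‖ ≤ 1 := by split_ifs <;> simp
  have hsq : ‖((Real.sqrt n / Real.sqrt m : ℝ) : ℂ)‖ = Real.sqrt n / Real.sqrt m := by
    rw [Complex.norm_real, Real.norm_eq_abs, abs_of_nonneg (by positivity)]
  have hJ := hK N m n hm
  have hNpow : (N : ℝ) ^ (-(5 / 4 : ℝ)) ≤ 1 :=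
    Real.rpow_le_one_of_one_le_of_nonpos hN1 (by norm_num)
  rw [poincareCoeff]
  refine (norm_sub_le _ _).trans ?_
  rw [norm_mul, hsq]
  have hsm : Real.sqrt (m : ℝ) ≠ 0 := (Real.sqrt_pos.mpr hm0).ne'
  -- `√(m,n) ≤ √n`, `N^{-5/4} ≤ 1`
  have hg' : Real.sqrt ((m.gcd n : ℕ) : ℝ) ≤ Real.sqrt n :=
    Real.sqrt_le_sqrt (by exact_mod_cast Nat.gcd_le_right (m := m) (Nat.pos_of_ne_zero (by omega)))
  have hJ'' : ‖petJ N m n‖ ≤ K * Real.sqrt n * Real.sqrt ((m : ℝ) * n) := by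
    refine hJ.trans ?_
    calc K * Real.sqrt ((m.gcd n : ℕ) : ℝ) * Real.sqrt ((m : ℝ) * n) * (N : ℝ) ^ (-(5 / 4 : ℝ))
        ≤ K * Real.sqrt n * Real.sqrt ((m : ℝ) * n) * 1 := by gcongr
      _ = K * Real.sqrt n * Real.sqrt ((m : ℝ) * n) := mul_one _
  have hkey' : Real.sqrt n / Real.sqrt m * (K * Real.sqrt n * Real.sqrt ((m : ℝ) * n)) =
      K * n * Real.sqrt n := by
    rw [Real.sqrt_mul hm0.le]
    field_simp
    rw [Real.sq_sqrt hn0.le]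
    ring
  calc ‖(if m = n then (1 : ℂ) else 0)‖ + Real.sqrt n / Real.sqrt m * ‖petJ N m n‖
      ≤ 1 + Real.sqrt n / Real.sqrt m * (K * Real.sqrt n * Real.sqrt ((m : ℝ) * n)) := by
        gcongr
    _ = 1 + K * n * Real.sqrt n := by rw [hkey']

end Literature.NumberTheory.LFunctions.KowalskiMichel2000

end
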